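import Summits.HodgeConjecture.HodgeConjecture.Theorems.F0P6aPELInputsSpread   -- ★ previous part of the same Lines workfile `F0_P6a_PELInputs` (size-lint split ×3)
import HarnessLib

/-!
# `F0P6aPELInputsRows` — ★ RE-HOME of `Lines/F0_P6a_PELInputs.lean`, PART 2 of 3 (size-lint split; cut at a declaration boundary).

See PART 1 `Theorems/F0P6aPELInputsSpread.lean` for the full re-home header and the original module docstring (verbatim there). Namespaces and sections KEPT
(re-opened below exactly as they stand at the cut, with their `open`∕`variable` lines replayed); code bytes = the workfile՚s, docstrings included; options preamble repeated from PART 1.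
HC_CM is proved only modulo the 7 printed citations (2 remaining: hLiu418 = stmt-HodgeConjecture-24832, h413 = stmt-HodgeConjecture-24833) until rung 0 closes; a re-home is count-neutral. -/

set_option autoImplicit false

noncomputable section

namespace Summit.HodgeConjecture.HodgeConjecture.Cruxes.HLiu418.F0P6aPELInputs
set_option linter.dupNamespace false  -- `Summit.HodgeConjecture.HodgeConjecture.…` BY DESIGN (D-0017)
open CategoryTheory CategoryTheory.Limits NumberField IsDedekindDomain MulAction
open scoped Matrix Polynomial Pointwise
open Literature.NumberTheory.GaloisRepresentations
open Literature.NumberTheory.Automorphic Literature.NumberTheory.Automorphic.UnitaryGroup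
open Literature.AlgebraicGeometry.ShimuraVarieties.UnitaryCanonicalModel
open Literature.NumberTheory.Automorphic.Liu2021.AppendixC
open Literature.AlgebraicGeometry.Motives (AlgPoints IntegralModel SchemeOver thickening thickeningGalAction thickeningLift)
open Literature.NumberTheory.DiophantineGeometry (geomResidueField specialFibreFunctor)
open Literature.AlgebraicGeometry.RelativeSpec (ActionOver)
open Literature.NumberTheory.EllipticCurves (genericFibre)
open AlgebraicGeometry (QuasiCompact QuasiSeparated LocallyOfFinitePresentation Flat IsSeparated)
open Summit.HodgeConjecture.HodgeConjecture.Cruxes.HLiu418.F0P6aModuliDatumDefs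
open Summit.HodgeConjecture.HodgeConjecture.Cruxes.HLiu418.F0P6aRGDAssembly
open Summit.HodgeConjecture.HodgeConjecture.Cruxes.HLiu418.F0P6aPELWitnessE (PELWitnessE IsCMTypeThrough)
open Summit.HodgeConjecture.HodgeConjecture.Cruxes.HLiu418.F0P6aIsomSchemeFiniteType (TupleIsoAt₂)
open Summit.HodgeConjecture.HodgeConjecture.Cruxes.HLiu418.F0P6aStubKOTT (KottAdaptedAt UnmixedAt kottwitzΩ_of_gen_iso conjugate_comp_eq
  mOf_comp_eq_of_unmixedAt)
open Summit.HodgeConjecture.HodgeConjecture.Cruxes.HLiu418.F0P6aPELWitnessE (mOf)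
open Summit.HodgeConjecture.HodgeConjecture.Theorems.F0P6aKottwitzCountAtSplitPlace (exists_restrict ker_residue_restrict_structural
  ker_residue_restrict_structural_comp_complexConj sum_filter_ker_residue_restrict_eq_one)
open Summit.HodgeConjecture.HodgeConjecture.Theorems.F0P6aKottwitzAtOmegaOfComplexPoints (exists_ringHom_comp_eq)


/-- **THE ZIP `inputsOfParts … T hJ0 hH hT hK hinjΩ : RGDInputsAt …`** — a spread with provenance, its three folded laws, its Kottwitz rows (`stub_KOTT`)
and (L1) `injΩ` (`stub_INJ`) ARE a localised PEL tuple with its laws (the 41 fields of `RGDInputsAt` ED. 5 by name — ED. 3: + the law row `hunr := hunr` fed by ONE new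
hypothesis `hunr : 𝔭_w² ∤ (T.pChar)` (LEAD «M-71» (1) = (H1)); `g N hg` from the E-witness; data inside the existentials
`PELTwistLawAt`∕`PELKottLawAt` by `.choose`).  Definitional. [cite: RapoportSmithlingZhang2020Diagonal, §4.1 p. 17] -/
def inputsOfParts (F : Type) [Field F] [NumberField F] [IsCMField F] (ι₁ : F →+* ℂ)
    (Jstar : Matrix (Fin 2) (Fin 2) F)
    (K₀ : C5.OpenCompactSubgroup ↥(finAdelic ↥(maximalRealSubfield F) F (IsCMField.complexConj F) 2 Jstar))
    (S : RecordSystemGS F Jstar ι₁ K₀) (hU7ₛ : S.HeckeTranslateDefinedOver)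
    (hJ : (Jstar.map (IsCMField.complexConj F))ᵀ = Jstar) (hJu : IsUnit Jstar)
    (Fi : Type) [Field Fi] [NumberField Fi] [Algebra F Fi] (Kc : C5.SmallLevel K₀) (G : Type) [Group G]
    (𝓜 : IntegralModel (𝓞 F) F ((thickening F Fi).obj (S.M.obj Kc)))
    (w : HeightOneSpectrum (𝓞 F)) (hw : (IsCMField.complexConj F) • w ≠ w) (h𝓨 : (𝓜.localise w).IsSmoothProper 1)
    (θ : ActionOver (𝓜.localise w).total.hom ((Fi ≃ₐ[F] Fi) × G))
    (e : Fi →ₐ[F] AlgebraicClosure (w.adicCompletion F))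
    (T : PELSpreadAt F ι₁ Jstar K₀ S hU7ₛ hJ hJu Fi Kc G 𝓜 w hw h𝓨 θ e)
    (hJ0 : PELInj0LawAt F ι₁ Jstar K₀ S hU7ₛ hJ hJu Fi Kc G 𝓜 w hw h𝓨 θ e T) (hH : PELHeckeLawAt F ι₁ Jstar K₀ S hU7ₛ hJ hJu Fi Kc G 𝓜 w hw h𝓨 θ e T)
    (hT : PELTwistLawAt F ι₁ Jstar K₀ S hU7ₛ hJ hJu Fi Kc G 𝓜 w hw h𝓨 θ e T) (hK : PELKottLawAt F ι₁ Jstar K₀ S hU7ₛ hJ hJu Fi Kc G 𝓜 w hw h𝓨 θ e T)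
    (hinjΩ : ∀ (e' : Fi →ₐ[F] AlgebraicClosure (w.adicCompletion F)) (y₁ y₂ : AlgPoints (S.M.obj Kc) (AlgebraicClosure (w.adicCompletion F))),
      tupleIsoAt (genPt S Kc 𝓜 w e' y₁) (genPt S Kc 𝓜 w e' y₂) T.univ T.act T.dual T.pol T.lvl → y₁ = y₂)
    (hunr : ¬ (w.asIdeal ^ 2 ∣ Ideal.span {((T.pChar : ℕ) : 𝓞 F)})) :
    RGDInputsAt F ι₁ Jstar K₀ S hU7ₛ hJ hJu Fi Kc G 𝓜 w hw h𝓨 θ e where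
  univ := T.univ
  act := T.act
  dual := T.dual
  pol := T.pol
  g := T.E.g
  N := T.E.N
  lvl := T.lvl
  hg := T.E.hg
  relDim := T.relDim
  comm := T.comm
  rosati := T.rosati
  m := hK.choose
  kottwitzΩ := hK.choose_spec.choose_spec.2.2.1
  τR := hK.choose_spec.choose
  τR_spec := hK.choose_spec.choose_spec.1
  m_count := hK.choose_spec.choose_spec.2.1
  pChar := T.pChar
  hpChar := T.hpChar
  hunr := hunr
  fDeg := T.fDeg
  hpCharConj := T.hpCharConj
  hfDeg := T.hfDeg
  charP₀ := T.charP₀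
  twistIdeal := hT.choose
  twistNorm := hT.choose_spec.choose
  twistNorm_spec := hT.choose_spec.choose_spec.1
  twistIdeal_coprime := hT.choose_spec.choose_spec.2.1
  twistIdeal_ne_bot := hT.choose_spec.choose_spec.2.2.1
  polQuasiInv := T.polQuasiInv
  twistIdeal_frob := hT.choose_spec.choose_spec.2.2.2.1
  twistNorm_frob := hT.choose_spec.choose_spec.2.2.2.2.1
  m_pair := hK.choose_spec.choose_spec.2.2.2.1
  m_banal := hK.choose_spec.choose_spec.2.2.2.2.1
  twistIdeal_coprime_conj := hT.choose_spec.choose_spec.2.2.2.2.2.1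
  frobKernel_banal := hT.choose_spec.choose_spec.2.2.2.2.2.2.1
  m_unmixed := hK.choose_spec.choose_spec.2.2.2.2.2
  inj₀ := hJ0
  injΩ := hinjΩ
  heckeRoofΩ := hH
  coverKerΩ := hT.choose_spec.choose_spec.2.2.2.2.2.2.2.1
  coverΩ := hT.choose_spec.choose_spec.2.2.2.2.2.2.2.2

/-- **`ESepAt S Kc w E` — E-SIDE POINT SEPARATION ON EVERY SHEET** (F0P5a-ref1 (g8) n5 (R1) `E_sep`): at the `w`-adic geometric points, two record points
`y₁ y₂` read on the same sheet `e′` whose E-tuples `(E.P.A, E.ρ, E.P.D, E.P.pol, E.P.level)` at `ℓ_{e′} y₁`, `ℓ_{e′} y₂` are isomorphic (★ Defs `tupleIsoAt`: EXACT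
level, EXACT `λ`, Poincaré bundle, `𝒪_F`-equivariant) are EQUAL — the moduli property of door (E)՚s witness (`ε` injective on the slice: ★
`UnitaryCurve.eq_of_forall_siegelPointMap_eq` + Deligne stationarity, composed with Siegel `classify`).  TODAY an OBLIGATION inside `stub_SPREAD`՚s existential
for the `E` it uses; TOMORROW the E-line՚s export `sep` in the TYPE `PELWitnessE` (ED. 2 road).  NOT asserted; false for a junk `E` (constant families).
[cite: MumfordFogartyKirwan1994, Ch. 7 §2 Def. 7.2 p. 129; §3 Thm. 7.9 p. 139] [cite: RapoportSmithlingZhang2020Diagonal, §4.1 p. 17] -/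
def ESepAt {F : Type} [Field F] [NumberField F] [IsCMField F] {ι₁ : F →+* ℂ} {Jstar : Matrix (Fin 2) (Fin 2) F}
    {K₀ : C5.OpenCompactSubgroup ↥(finAdelic ↥(maximalRealSubfield F) F (IsCMField.complexConj F) 2 Jstar)}
    (S : RecordSystemGS F Jstar ι₁ K₀) {Fi : Type} [Field Fi] [NumberField Fi] [Algebra F Fi] (Kc : C5.SmallLevel K₀)
    (w : HeightOneSpectrum (𝓞 F)) {τE : Fi →+* ℂ} {Φ : Set (F →+* ℂ)} (E : PELWitnessE F ι₁ Jstar K₀ S Kc Fi τE Φ) : Prop :=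
  ∀ (e' : Fi →ₐ[F] AlgebraicClosure (w.adicCompletion F)) (y₁ y₂ : AlgPoints (S.M.obj Kc) (AlgebraicClosure (w.adicCompletion F))),
    tupleIsoAt (thickeningLift e' (S.M.obj Kc) y₁).left (thickeningLift e' (S.M.obj Kc) y₂).left E.P.A E.ρ E.P.D E.P.pol E.P.level → y₁ = y₂

/-! ### §0b The Kottwitz SIGNATURE ROWS of the frame, BY DEFINITION of `mOf` (v6g, spine ED. 4 rows `m_pair`∕`m_banal`; `m_unmixed` = KOTT ED. 2 `mOf_comp_eq_of_unmixedAt`) -/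

section SignatureRows

variable {F : Type} [Field F] [NumberField F] [IsCMField F]

omit [NumberField F] [IsCMField F] in
/-- (B-1, row `m_pair`) **THE FRAME SIGNATURE PAIRS OFF TO `2`: `m φ + m φ̄ = 2`** for a CM type `Φ` through `ι₁` — by definition of `mOf` (`1 + 1` on the
pair `{ι₁, ῑ₁}`, `0 + 2` ∕ `2 + 0` off it since exactly one of `φ, φ̄` lies in `Φ`). [cite: RapoportSmithlingZhang2020Diagonal, §3.2 (3.8) p. 11, Rem. 3.6 (3.14) p. 13] -/
theorem mOf_add_mOf_conjugate_eq_two (ι₁ : F →+* ℂ) (Φ : Set (F →+* ℂ)) (hΦ : IsCMTypeThrough ι₁ Φ) (φ : F →+* ℂ) :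
    mOf ι₁ Φ φ + mOf ι₁ Φ (ComplexEmbedding.conjugate φ) = 2 := by
  classical
  have hinv : ComplexEmbedding.conjugate (ComplexEmbedding.conjugate φ) = φ := ComplexEmbedding.involutive_conjugate F φ
  by_cases h₁ : φ = ι₁
  · subst h₁
    simp only [mOf, true_or, if_true, or_true]
  by_cases h₂ : φ = ComplexEmbedding.conjugate ι₁
  · subst h₂
    simp only [mOf, or_true, if_true, ComplexEmbedding.involutive_conjugate F ι₁, true_or]
  have h₃ : ComplexEmbedding.conjugate φ ≠ ι₁ := fun h => h₂ (by rw [← h, hinv])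
  have h₄ : ComplexEmbedding.conjugate φ ≠ ComplexEmbedding.conjugate ι₁ := fun h =>
    h₁ ((ComplexEmbedding.involutive_conjugate F).injective h)
  by_cases hφ : φ ∈ Φ
  · have hφ' : ComplexEmbedding.conjugate φ ∉ Φ := (hΦ.2 φ).mp hφ
    simp only [mOf, h₁, h₂, or_self, if_false, hφ, if_true, h₃, h₄, hφ']
  · have hφ' : ComplexEmbedding.conjugate φ ∈ Φ := by
      by_contra h
      exact hφ ((hΦ.2 φ).mpr h)
    simp only [mOf, h₁, h₂, or_self, if_false, hφ, h₃, h₄, hφ', if_true]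

/-- (B-1, row `m_pair` in the spine՚s tokens) `m τ + m (τ ∘ c) = 2` for `m := mOf ι₁ Φ ∘ (σ₀ ∘ ·)` (KOTT leaf `conjugate_comp_eq`). [cite: RapoportSmithlingZhang2020Diagonal, §3.2 (3.8) p. 11] -/
theorem mOf_comp_add_mOf_comp_complexConj_eq_two (ι₁ : F →+* ℂ) (Φ : Set (F →+* ℂ)) (hΦ : IsCMTypeThrough ι₁ Φ)
    (w : HeightOneSpectrum (𝓞 F)) (σ₀ : AlgebraicClosure (w.adicCompletion F) →+* ℂ) (τ : F →+* AlgebraicClosure (w.adicCompletion F)) :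
    mOf ι₁ Φ (σ₀.comp τ) + mOf ι₁ Φ (σ₀.comp (τ.comp ((IsCMField.complexConj F : F ≃ₐ[↥(maximalRealSubfield F)] F) : F →+* F))) = 2 := by
  rw [← conjugate_comp_eq w σ₀ τ]
  exact mOf_add_mOf_conjugate_eq_two ι₁ Φ hΦ (σ₀.comp τ)

omit [IsCMField F] in
/-- **Off the structural embedding**: an embedding `τ : F →+* F̄_w` whose induced prime is not `𝔭_w` has complex partner `σ₀ ∘ τ ≠ ι₁` (`σ₀ ∘ τ_w = ι₁`, `σ₀ ∘ ·`
injective, ★ p847313 `ker_residue_restrict_structural`). [cite: RapoportSmithlingZhang2020Diagonal, §4.1 p. 17] -/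
theorem comp_ne_of_ker_ne (ι₁ : F →+* ℂ) (w : HeightOneSpectrum (𝓞 F))
    (τR : (F →+* AlgebraicClosure (w.adicCompletion F)) → (𝓞 F →+* ↥(closureValuationSubring (w.adicCompletion F))))
    (hτR : ∀ (τ : F →+* AlgebraicClosure (w.adicCompletion F)) (x : 𝓞 F),
      ((τR τ x : ↥(closureValuationSubring (w.adicCompletion F))) : AlgebraicClosure (w.adicCompletion F)) = τ (x : F))
    (σ₀ : AlgebraicClosure (w.adicCompletion F) →+* ℂ)
    (hσ₀ : σ₀.comp ((algebraMap (w.adicCompletion F) (AlgebraicClosure (w.adicCompletion F))).comp (algebraMap F (w.adicCompletion F))) = ι₁)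
    (τ : F →+* AlgebraicClosure (w.adicCompletion F))
    (h : RingHom.ker ((IsLocalRing.residue ↥(closureValuationSubring (w.adicCompletion F))).comp (τR τ)) ≠ (w.asIdeal : Ideal (𝓞 F))) :
    σ₀.comp τ ≠ ι₁ := by
  intro hτ
  apply h
  have hτw : τ = (algebraMap (w.adicCompletion F) (AlgebraicClosure (w.adicCompletion F))).comp (algebraMap F (w.adicCompletion F)) :=
    RingHom.ext fun x => σ₀.injective (by rw [← RingHom.comp_apply, ← RingHom.comp_apply, hτ, hσ₀])
  rw [hτw]
  exact ker_residue_restrict_structural w τR hτR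

/-- **Off `τ_w ∘ c`**: an embedding whose induced prime is not `𝔭_{c•w}` has complex partner `σ₀ ∘ τ ≠ ῑ₁` (`σ₀ ∘ (τ_w ∘ c) = ῑ₁`, ★ p847313
`ker_residue_restrict_structural_comp_complexConj`). [cite: RapoportSmithlingZhang2020Diagonal, §4.1 p. 17; §4.1 (4.6)–(4.8) p. 16 (banal signature type); App. B p. 58] -/
theorem comp_ne_conjugate_of_ker_ne (ι₁ : F →+* ℂ) (w : HeightOneSpectrum (𝓞 F))
    (τR : (F →+* AlgebraicClosure (w.adicCompletion F)) → (𝓞 F →+* ↥(closureValuationSubring (w.adicCompletion F))))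
    (hτR : ∀ (τ : F →+* AlgebraicClosure (w.adicCompletion F)) (x : 𝓞 F),
      ((τR τ x : ↥(closureValuationSubring (w.adicCompletion F))) : AlgebraicClosure (w.adicCompletion F)) = τ (x : F))
    (σ₀ : AlgebraicClosure (w.adicCompletion F) →+* ℂ)
    (hσ₀ : σ₀.comp ((algebraMap (w.adicCompletion F) (AlgebraicClosure (w.adicCompletion F))).comp (algebraMap F (w.adicCompletion F))) = ι₁)
    (τ : F →+* AlgebraicClosure (w.adicCompletion F))
    (h : RingHom.ker ((IsLocalRing.residue ↥(closureValuationSubring (w.adicCompletion F))).comp (τR τ)) ≠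
      (((IsCMField.complexConj F) • w).asIdeal : Ideal (𝓞 F))) :
    σ₀.comp τ ≠ ComplexEmbedding.conjugate ι₁ := by
  intro hτ
  apply h
  have hτwc : σ₀.comp (((algebraMap (w.adicCompletion F) (AlgebraicClosure (w.adicCompletion F))).comp
      (algebraMap F (w.adicCompletion F))).comp ((IsCMField.complexConj F : F ≃ₐ[↥(maximalRealSubfield F)] F) : F →+* F)) =
      ComplexEmbedding.conjugate ι₁ := by
    rw [← conjugate_comp_eq w σ₀, hσ₀]
  have hτw : τ = (((algebraMap (w.adicCompletion F) (AlgebraicClosure (w.adicCompletion F))).comp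
      (algebraMap F (w.adicCompletion F))).comp ((IsCMField.complexConj F : F ≃ₐ[↥(maximalRealSubfield F)] F) : F →+* F)) :=
    RingHom.ext fun x => σ₀.injective (by
      have h1 := RingHom.congr_fun hτ x
      have h2 := RingHom.congr_fun hτwc x
      rw [RingHom.comp_apply] at h1 h2
      rw [h1, h2])
  rw [hτw]
  exact ker_residue_restrict_structural_comp_complexConj w τR hτR

/-- (B-1, row `m_banal`) **THE BANAL VALUES `m τ ∈ {0, 2}`** at every `τ` inducing neither `w` nor `c•w`, for `m := mOf ι₁ Φ ∘ (σ₀ ∘ ·)` — by definition of `mOf`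
(`σ₀ ∘ τ ∉ {ι₁, ῑ₁}`). [cite: RapoportSmithlingZhang2020Diagonal, §3.2 (3.8) p. 11, Rem. 3.6 (3.14) p. 13] [cite: Kottwitz1992, §5 p. 390] -/
theorem mOf_comp_eq_zero_or_two_of_ker_ne (ι₁ : F →+* ℂ) (Φ : Set (F →+* ℂ)) (w : HeightOneSpectrum (𝓞 F))
    (τR : (F →+* AlgebraicClosure (w.adicCompletion F)) → (𝓞 F →+* ↥(closureValuationSubring (w.adicCompletion F))))
    (hτR : ∀ (τ : F →+* AlgebraicClosure (w.adicCompletion F)) (x : 𝓞 F),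
      ((τR τ x : ↥(closureValuationSubring (w.adicCompletion F))) : AlgebraicClosure (w.adicCompletion F)) = τ (x : F))
    (σ₀ : AlgebraicClosure (w.adicCompletion F) →+* ℂ)
    (hσ₀ : σ₀.comp ((algebraMap (w.adicCompletion F) (AlgebraicClosure (w.adicCompletion F))).comp (algebraMap F (w.adicCompletion F))) = ι₁)
    (τ : F →+* AlgebraicClosure (w.adicCompletion F))
    (h₁ : RingHom.ker ((IsLocalRing.residue ↥(closureValuationSubring (w.adicCompletion F))).comp (τR τ)) ≠ (w.asIdeal : Ideal (𝓞 F)))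
    (h₂ : RingHom.ker ((IsLocalRing.residue ↥(closureValuationSubring (w.adicCompletion F))).comp (τR τ)) ≠
      (((IsCMField.complexConj F) • w).asIdeal : Ideal (𝓞 F))) :
    mOf ι₁ Φ (σ₀.comp τ) = 0 ∨ mOf ι₁ Φ (σ₀.comp τ) = 2 := by
  classical
  have hn₁ := comp_ne_of_ker_ne ι₁ w τR hτR σ₀ hσ₀ τ h₁
  have hn₂ := comp_ne_conjugate_of_ker_ne ι₁ w τR hτR σ₀ hσ₀ τ h₂
  by_cases hΦ : σ₀.comp τ ∈ Φ
  · left; simp only [mOf, hn₁, hn₂, or_self, if_false, hΦ, if_true]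
  · right; simp only [mOf, hn₁, hn₂, or_self, if_false, hΦ]

end SignatureRows

/-! ### §0c THE KOTTWITZ ROWS ON THE EXPLICIT FRAME SIGNATURE `m₀ := mOf ι₁ T.Φ (σ₀ ∘ ·)` — HOISTED (LA4-p02 (g0), DEAL #14; LA4-p04 (g0) SNIPPET 579af007 «suggest hoisting»)

HOME (desk F0P6a-plan (g4) 04:15:11Z): THIS P-line, ED. 2, right after §0b — `stub_KOTT` (§2) re-closes through it in 9 lines; LA4-p04՚s row-(7) payer
`frobKernelBanal₀_of_kottRows` is CONSUMER-side (leaf `F0_P6a_PELSpread` ED. 2, next to the E-READINGS (FROB-can) pin) and is NOT imported here.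
CONSUMERS: (i) `stub_KOTT` (`⟨m₀, τR, hτR, kottRows_explicit T σ₀ hσ₀ τR hτR⟩`); (ii) GEN՚s `elaws_of_parts` row (7) `frobKernel_banal` via LA4-p04՚s payer
`frobKernelBanal₀_of_kottRows` fed by the E-READINGS ED. 2 `ETwistKerAt` pin (FROB-can) `hpin σ₀ hσ₀ τR hτR σ hσ γ hγ : twistIdeal γ = 𝔞_can(m₀, τR, w)`:
`obtain ⟨hcount, hKΩ, hpair, hbanal, hunmixed⟩ := kottRows_explicit T σ₀ hσ₀ τR hτR` once per `(σ₀, τR)`, then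
`fun σ hσ γ hγ => frobKernelBanal₀_of_kottRows T _ τR hτR hcount hKΩ hpair hbanal hunmixed (hpin σ₀ hσ₀ τR hτR σ hσ γ hγ)`.
`σ₀`՚s hypothesis is in the PIN՚s form `σ₀ ∘ algebraMap F F̄_w = ι₁` (the `K̂_w`-tower form used by `T.hΦw`∕§0b is derived inside, `IsScalarTower.algebraMap_eq`). -/

/-- **THE FIVE KOTTWITZ ROWS OF `PELKottLawAt … T` ON THE EXPLICIT SIGNATURE `m₀ := fun τ => mOf ι₁ T.Φ (σ₀.comp τ)`, FOR EVERY complex embedding `σ₀` of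
`F̄_w` over `ι₁` and EVERY restriction family `τR` (`τR τ = τ|_{𝒪_F}`)** — the conjuncts of `PELKottLawAt … T` after `τR_spec`, token for token with `m ↦ m₀`
(so that `⟨m₀, τR, hτR, kottRows_explicit T σ₀ hσ₀ τR hτR⟩ : PELKottLawAt … T`): THE COUNT «the `c•w`-block of `Lie` is a line» `∑_{τ ↦ c•w} m₀ τ = 1`
(★ p847313 `sum_filter_ker_residue_restrict_eq_one` under (K-prov-2) `T.hΦw`; `σ₀ ∘ τ_w = ι₁`, `σ₀ ∘ (τ_w ∘ c) = ῑ₁`, `σ₀ ∘ ·` injective), KOTTWITZ AT EVERY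
`Ω`-POINT OF EVERY SHEET `KottwitzΩ S Kc 𝓜 w T.univ T.act m₀` (KOTT leaf `kottwitzΩ_of_gen_iso`: `T.E.kottwitz` transported along `T.gen_iso`, (K-prov-1) `T.hτE`),
and the three SIGNATURE ROWS (B-1) `m₀ τ + m₀ (τ ∘ c) = 2` (§0b, `T.hΦ`), `m₀ τ ∈ {0, 2}` off the pair `{w, c•w}` (§0b) and `m₀` constant on every banal block
(KOTT ED. 2 `mOf_comp_eq_of_unmixedAt`, (K-prov-3) `T.hΦu`).  The computation of `stub_KOTT` (v6g) with the existential opened: `σ₀` and `τR` are INPUTS, so the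
row-(7) payer at the canonical twist ideal `𝔞_can(m₀, τR, w)` (LA4-p04 `frobKernelBanal₀_of_kottRows`, ★ p848302) and the E-side pin (FROB-can) of `ETwistKerAt`
read THE SAME `m₀`. [cite: Kottwitz1992, §5 pp. 389–391] [cite: RapoportSmithlingZhang2020Diagonal, §4.1 (4.6) p. 16 and p. 17; §3.2 (3.8) p. 11; Remark 3.6 (i) (3.14) p. 13] -/
theorem kottRows_explicit {F : Type} [Field F] [NumberField F] [IsCMField F] [IsGalois ℚ F] {ι₁ : F →+* ℂ}
    {Jstar : Matrix (Fin 2) (Fin 2) F}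
    {K₀ : C5.OpenCompactSubgroup ↥(finAdelic ↥(maximalRealSubfield F) F (IsCMField.complexConj F) 2 Jstar)}
    {S : RecordSystemGS F Jstar ι₁ K₀} {hU7ₛ : S.HeckeTranslateDefinedOver}
    {hJ : (Jstar.map (IsCMField.complexConj F))ᵀ = Jstar} {hJu : IsUnit Jstar}
    {Fi : Type} [Field Fi] [NumberField Fi] [Algebra F Fi] {Kc : C5.SmallLevel K₀} {G : Type} [Group G]
    {𝓜 : IntegralModel (𝓞 F) F ((thickening F Fi).obj (S.M.obj Kc))}
    {w : HeightOneSpectrum (𝓞 F)} {hw : (IsCMField.complexConj F) • w ≠ w} {h𝓨 : (𝓜.localise w).IsSmoothProper 1}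
    {θ : ActionOver (𝓜.localise w).total.hom ((Fi ≃ₐ[F] Fi) × G)}
    {e : Fi →ₐ[F] AlgebraicClosure (w.adicCompletion F)}
    (T : PELSpreadAt F ι₁ Jstar K₀ S hU7ₛ hJ hJu Fi Kc G 𝓜 w hw h𝓨 θ e)
    (σ₀ : AlgebraicClosure (w.adicCompletion F) →+* ℂ)
    (hσ₀ : σ₀.comp (algebraMap F (AlgebraicClosure (w.adicCompletion F))) = ι₁)
    (τR : (F →+* AlgebraicClosure (w.adicCompletion F)) → (𝓞 F →+* ↥(closureValuationSubring (w.adicCompletion F))))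
    (hτR : ∀ (τ : F →+* AlgebraicClosure (w.adicCompletion F)) (x : 𝓞 F),
      ((τR τ x : ↥(closureValuationSubring (w.adicCompletion F))) : AlgebraicClosure (w.adicCompletion F)) = τ (x : F)) :
    (∑ τ ∈ (Finset.univ.filter fun τ : F →+* AlgebraicClosure (w.adicCompletion F) =>
        RingHom.ker ((IsLocalRing.residue ↥(closureValuationSubring (w.adicCompletion F))).comp (τR τ)) =
          (((IsCMField.complexConj F) • w).asIdeal : Ideal (𝓞 F))), mOf ι₁ T.Φ (σ₀.comp τ) = 1) ∧
    KottwitzΩ S Kc 𝓜 w T.univ T.act (fun τ => mOf ι₁ T.Φ (σ₀.comp τ)) ∧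
    (∀ τ : F →+* AlgebraicClosure (w.adicCompletion F),
      mOf ι₁ T.Φ (σ₀.comp τ) +
        mOf ι₁ T.Φ (σ₀.comp (τ.comp ((IsCMField.complexConj F : F ≃ₐ[↥(maximalRealSubfield F)] F) : F →+* F))) = 2) ∧
    (∀ τ : F →+* AlgebraicClosure (w.adicCompletion F),
      RingHom.ker ((IsLocalRing.residue ↥(closureValuationSubring (w.adicCompletion F))).comp (τR τ)) ≠ (w.asIdeal : Ideal (𝓞 F)) →
      RingHom.ker ((IsLocalRing.residue ↥(closureValuationSubring (w.adicCompletion F))).comp (τR τ)) ≠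
        (((IsCMField.complexConj F) • w).asIdeal : Ideal (𝓞 F)) →
      mOf ι₁ T.Φ (σ₀.comp τ) = 0 ∨ mOf ι₁ T.Φ (σ₀.comp τ) = 2) ∧
    (∀ τ τ' : F →+* AlgebraicClosure (w.adicCompletion F),
      RingHom.ker ((IsLocalRing.residue ↥(closureValuationSubring (w.adicCompletion F))).comp (τR τ)) =
        RingHom.ker ((IsLocalRing.residue ↥(closureValuationSubring (w.adicCompletion F))).comp (τR τ')) →
      RingHom.ker ((IsLocalRing.residue ↥(closureValuationSubring (w.adicCompletion F))).comp (τR τ)) ≠ w.asIdeal →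
      RingHom.ker ((IsLocalRing.residue ↥(closureValuationSubring (w.adicCompletion F))).comp (τR τ)) ≠
        ((IsCMField.complexConj F) • w).asIdeal →
      mOf ι₁ T.Φ (σ₀.comp τ) = mOf ι₁ T.Φ (σ₀.comp τ')) := by
  classical
  -- the `K̂_w`-tower form of `hσ₀` (the form `T.hΦw`, `T.hΦu` and §0b read)
  have hσ₀' : σ₀.comp ((algebraMap (w.adicCompletion F) (AlgebraicClosure (w.adicCompletion F))).comp
      (algebraMap F (w.adicCompletion F))) = ι₁ := by
    rw [← IsScalarTower.algebraMap_eq]; exact hσ₀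
  refine ⟨?_,
    kottwitzΩ_of_gen_iso S Kc 𝓜 w T.univ T.act T.dual T.pol T.lvl T.E.P.A T.E.ρ T.E.P.D T.E.P.pol T.E.P.level T.τE T.Φ
      T.E.kottwitz T.gen_iso σ₀ hσ₀ T.hτE,
    fun τ => mOf_comp_add_mOf_comp_complexConj_eq_two ι₁ T.Φ T.hΦ w σ₀ τ,
    fun τ h₁ h₂ => mOf_comp_eq_zero_or_two_of_ker_ne ι₁ T.Φ w τR hτR σ₀ hσ₀' τ h₁ h₂,
    fun τ τ' hker h₁ h₂ => mOf_comp_eq_of_unmixedAt ι₁ w T.Φ τR hτR σ₀ hσ₀' T.hΦu τ τ' hker h₁ h₂⟩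
  -- THE COUNT (the `stub_KOTT` v6g computation): `τ_w ↦ ι₁`, `τ_w ∘ c ↦ ῑ₁` under `σ₀`, `σ₀ ∘ ·` injective
  have hτwc : σ₀.comp (((algebraMap (w.adicCompletion F) (AlgebraicClosure (w.adicCompletion F))).comp
      (algebraMap F (w.adicCompletion F))).comp ((IsCMField.complexConj F : F ≃ₐ[↥(maximalRealSubfield F)] F) : F →+* F)) =
      ComplexEmbedding.conjugate ι₁ := by
    rw [← conjugate_comp_eq w σ₀, hσ₀']
  have hinj : ∀ τ τ' : F →+* AlgebraicClosure (w.adicCompletion F), σ₀.comp τ = σ₀.comp τ' → τ = τ' :=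
    fun τ τ' h => RingHom.ext fun x => σ₀.injective (RingHom.congr_fun h x)
  refine sum_filter_ker_residue_restrict_eq_one w τR hτR hw (Finset.univ.filter fun τ => σ₀.comp τ ∈ T.Φ) _ ?_ ?_ ?_
  · intro τ hτ hne
    exact Finset.mem_filter.mpr ⟨Finset.mem_univ _, T.hΦw τR hτR σ₀ hσ₀' τ hτ hne⟩
  · show mOf ι₁ T.Φ _ = 1
    rw [hτwc]
    simp only [mOf, or_true, if_true]
  · intro τ hτ hne hnec
    have h₁ : σ₀.comp τ ≠ ι₁ := fun h => hne (hinj _ _ (h.trans hσ₀'.symm))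
    have h₂ : σ₀.comp τ ≠ ComplexEmbedding.conjugate ι₁ := fun h => hnec (hinj _ _ (h.trans hτwc.symm))
    show mOf ι₁ T.Φ _ = 0
    simp only [mOf, h₁, h₂, or_self, if_false, (Finset.mem_filter.mp hτ).2, if_true]

end Summit.HodgeConjecture.HodgeConjecture.Cruxes.HLiu418.F0P6aPELInputs
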